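import Summits.BirchSwinnertonDyer.BirchSwinnertonDyer.Theorems.ShaPrimaryTransferFiniteShaComponentTransferSelmerCubicKillLocalOne
import Summits.BirchSwinnertonDyer.BirchSwinnertonDyer.Theorems.ShaPrimaryTransferFiniteShaComponentTransferSelmerCubicCoverCl
import Literature.NumberTheory.EllipticCurves.TwoDescentOneRootKummerBridgeTower
import HarnessLib

/-!
# BirchSwinnertonDyer — SEL2CUBIC kill layer, assembled: a `2`-Selmer class never meets a killed class

HONEST FRAMING: route `ShaPrimaryTransfer`, seat `bsd-line-spt-p1` (g30), `--supports` item T =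
`FiniteShaComponentTransfer` (stmt-22356), UNCHANGED (conjecture-grade at corank ≥ 2). BSD in rank ≥ 2 is NOT
proved by any of this. THEOREMS ONLY.

The Selmer-class form of the kill layer's `not_isSquare_of_killValidAt`: let `E : y² = x³ + Ax² + Bx + C` over
`ℚ` with irreducible `2`-division cubic, `K = ℚ(α)` the cubic field of the certificate (field cubic `a b c`),
`θ = t₀ + t₁α + t₂α² ∈ 𝓞_K` the root of the curve cubic, `c ∈ Sel⁽²⁾(E/ℚ)` with Cassels class `Φ(c) = [a_K]`,
`z = z₀ + z₁α + z₂α² ≠ 0`, and a prime `p` at which some RESIDUE certificate holds («no `p`-primitive integer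
vector `v` with `p^N ∣ Q₁(v), Q₂(v)`», as supplied by `killCheck_sound_mod`, `sig3Check_sound_mod`, …). Then
`a_K · z ∉ K²` (`not_isSquare_sel_of_killResidue`): otherwise the local Cassels uniformity
(`isSquare_of_resTorsion_eq`: ONE point `P ∈ E(ℚ_p)` serves every `w ∣ p`) gives per-place solutions of
`z·ρ_w² = x(P) − θ` (resp. `= 1` when `P = O`) in every `K_w`, whence (`…KillLocal`, `…KillLocalOne`) a
`p`-primitive integer vector with `p^N ∣ Q₁, Q₂` — contradicting the certificate.
[cite: Cassels1991LecturesEllipticCurves, §15] [cite: SilvermanAEC2009, Prop. X.1.4, X.§4] [cite: CremonaAlgorithms1997, §3.6]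
-/

-- single-conjunct summit: `Summit.BirchSwinnertonDyer.BirchSwinnertonDyer.…` repeats the name by design
set_option linter.dupNamespace false

noncomputable section

open scoped Classical NumberField

namespace Summit.BirchSwinnertonDyer.BirchSwinnertonDyer.Theorems.ShaPrimaryTransferSelmerCubicKill

open Summit.BirchSwinnertonDyer.BirchSwinnertonDyer.Rank2Observatory
open Summit.BirchSwinnertonDyer.BirchSwinnertonDyer.Rank2Observatory.TwoDescKill
open Summit.BirchSwinnertonDyer.BirchSwinnertonDyer.Rank2Observatory.TwoDescCubic
open Summit.BirchSwinnertonDyer.BirchSwinnertonDyer.Theorems.ShaPrimaryTransferSelmerCubicCover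
open Literature.NumberTheory.NumberFields Literature.NumberTheory.EllipticCurves
  Literature.NumberTheory.GaloisRepresentations IsDedekindDomain NumberField Module Polynomial
open WeierstrassCurve WeierstrassCurve.Affine

variable {K : Type} [Field K] [NumberField K] {a b c : ℤ} {α : K} {A B C : ℤ}

/-- Per-place square roots: in a field `L`, from `a·z = t²`, `a ≠ 0`, `z ≠ 0` and `a·d = s²` get `ρ` with
`z·ρ² = d` (`ρ = s/t`). [folklore] -/
theorem exists_mul_sq_eq_of_sq {L : Type*} [Field L] {a z t d s : L} (ha : a ≠ 0) (hz : z ≠ 0)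
    (hazt : a * z = t * t) (hs : a * d = s * s) : ∃ ρ : L, z * ρ ^ 2 = d := by
  have ht : t ≠ 0 := by
    intro h0; rw [h0, mul_zero] at hazt; exact mul_ne_zero ha hz hazt
  refine ⟨s / t, ?_⟩
  field_simp
  linear_combination (-z) * hs + d * hazt

/-- **A `2`-Selmer class never meets a killed class (residue form).** See the module docstring.
[cite: Cassels1991LecturesEllipticCurves, §15] [cite: SilvermanAEC2009, Prop. X.1.4, X.§4 diagram (**)]
[cite: CremonaAlgorithms1997, §3.6] -/
theorem not_isSquare_sel_of_killResidue (hirr : Irreducible (MonicCubic.polyQ a b c))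
    (hα : aeval α (MonicCubic.poly a b c) = 0) (h3 : finrank ℚ K = 3)
    (E : WeierstrassCurve ℚ) [E.IsElliptic] (ha₁ : E.a₁ = 0) (ha₂ : E.a₂ = A) (ha₃ : E.a₃ = 0)
    (ha₄ : E.a₄ = B) (ha₆ : E.a₆ = C) (t₀ t₁ t₂ : ℤ)
    (hθ : aeval (algebraMap (𝓞 K) K (lin hα t₀ t₁ t₂)) (MonicCubic.poly A B C) = 0)
    [(E.baseChange K).IsElliptic]
    {cS : galH1Torsion E 2} (hcS : cS ∈ selmerGroup E 2) (aK : Kˣ)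
    (haK : kummerEquiv K 2 (E.oneRootDescentH1 K (isTwoTorsionX_of_aeval E ha₁ ha₂ ha₃ ha₄ ha₆ hθ) cS) =
      Additive.ofMul (QuotientGroup.mk aK))
    {p : ℕ} (hp : p.Prime) {z₀ z₁ z₂ : ℤ} (hz : (z₀, z₁, z₂) ≠ ((0 : ℤ), (0 : ℤ), (0 : ℤ)))
    (hres : ∃ N : ℕ, ∀ v : ℤ × ℤ × ℤ × ℤ,
      ¬ ((p : ℤ) ∣ v.1 ∧ (p : ℤ) ∣ v.2.1 ∧ (p : ℤ) ∣ v.2.2.1 ∧ (p : ℤ) ∣ v.2.2.2) →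
      (p : ℤ) ^ N ∣ (killQ a b c (z₀, z₁, z₂) t₁ t₂ v).1 → (p : ℤ) ^ N ∣ (killQ a b c (z₀, z₁, z₂) t₁ t₂ v).2 →
      False) :
    ¬ IsSquare ((aK : K) * ((z₀ : K) + (z₁ : K) * α + (z₂ : K) * α ^ 2)) := by
  rintro ⟨tK, htK⟩
  obtain ⟨N, hN⟩ := hres
  haveI : Fact p.Prime := ⟨hp⟩
  -- `z ≠ 0` in `K`
  have hZ : ((z₀ : K) + (z₁ : K) * α + (z₂ : K) * α ^ 2) ≠ 0 := by
    intro h0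
    have e : algebraMap ℚ K (z₂ : ℚ) * α ^ 2 + algebraMap ℚ K (z₁ : ℚ) * α + algebraMap ℚ K (z₀ : ℚ) = 0 := by
      simp only [map_intCast]; linear_combination h0
    obtain ⟨e₀, e₁, e₂⟩ := powIndep_algebraMap hirr hα h3 _ _ _ e
    exact hz (Prod.ext (by exact_mod_cast e₀) (Prod.ext (by exact_mod_cast e₁) (by exact_mod_cast e₂)))
  have hZ' : evZ α (z₀, z₁, z₂) = (z₀ : K) + (z₁ : K) * α + (z₂ : K) * α ^ 2 := rfl
  -- the place `v = p` of `ℚ` and a point `P ∈ E(ℚ_p)` carrying the class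
  set v : HeightOneSpectrum (𝓞 ℚ) := (Rat.HeightOneSpectrum.primesEquiv (R := 𝓞 ℚ)).symm ⟨p, hp⟩ with hv
  haveI : (E.baseChange (v.adicCompletion ℚ)).IsElliptic := E.isElliptic_baseChange _
  -- a point `P ∈ E(ℚ_p)` carrying the class (local condition at `v`; `Place.Completion (inr v) = ℚ_v`)
  obtain ⟨P, hP'⟩ : ∃ P : (E.baseChange (v.adicCompletion ℚ)).toAffine.Point,
      resTorsion E (v.adicCompletion ℚ) 2 cS =
        kummerMapTorsion (E.baseChange (v.adicCompletion ℚ)) 2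
          (E.two_zsmul_geomPoints_baseChange_surjective (v.adicCompletion ℚ)) P := by
    haveI : CharZero (NumberField.Place.Completion (K := ℚ) (Sum.inr v)) :=
      charZero_of_injective_algebraMap (algebraMap ℚ (v.adicCompletion ℚ)).injective
    haveI : (E.baseChange (NumberField.Place.Completion (K := ℚ) (Sum.inr v))).IsElliptic :=
      E.isElliptic_baseChange _
    exact E.exists_resTorsion_eq_kummerMapTorsion_of_mem_selmerGroup hcS (Sum.inr v)
  have hθE := isTwoTorsionX_of_aeval E ha₁ ha₂ ha₃ ha₄ ha₆ hθ
  have ha' : kummerEquiv K 2 ((E.baseChange K).oneRootCharH1 hθE (resTorsion E K 2 cS)) =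
      Additive.ofMul (QuotientGroup.mk aK) := by
    rw [← oneRootDescentH1_apply]; exact haK
  have hθlin : algebraMap (𝓞 K) K (lin hα t₀ t₁ t₂) = evZ α (t₀, t₁, t₂) := algebraMap_lin_evZ hα (t₀, t₁, t₂)
  -- per-place data at every `w ∣ p`
  have key : ∀ w : v.Extension (𝓞 K),
      (P = 0 → IsSquare (algebraMap K (w.1.adicCompletion K) (aK : K))) ∧
        ∀ {x y : v.adicCompletion ℚ} (hxy : (E.baseChange (v.adicCompletion ℚ)).toAffine.Nonsingular x y),
          P = Affine.Point.some x y hxy →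
          IsSquare (algebraMap K (w.1.adicCompletion K) (aK : K) *
            (algebraMap (v.adicCompletion ℚ) (w.1.adicCompletion K) x -
              algebraMap K (w.1.adicCompletion K) (algebraMap (𝓞 K) K (lin hα t₀ t₁ t₂)))) := by
    intro w
    -- pin the `ℚ`-algebra structure of `ℚ_v` (a local instance beats `DivisionRing.toRatAlgebra`)
    letI instQv : Algebra ℚ (v.adicCompletion ℚ) := inferInstance
    haveI : CharZero (v.adicCompletion ℚ) :=
      charZero_of_injective_algebraMap (algebraMap ℚ (v.adicCompletion ℚ)).injective
    haveI : CharZero (w.1.adicCompletion K) :=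
      charZero_of_injective_algebraMap (algebraMap K (w.1.adicCompletion K)).injective
    haveI : (E.baseChange (w.1.adicCompletion K)).IsElliptic := E.isElliptic_baseChange _
    haveI : ((E.baseChange K).baseChange (w.1.adicCompletion K)).IsElliptic := (E.baseChange K).isElliptic_baseChange _
    haveI : ((E.baseChange (v.adicCompletion ℚ)).baseChange (w.1.adicCompletion K)).IsElliptic :=
      (E.baseChange (v.adicCompletion ℚ)).isElliptic_baseChange _
    exact E.isSquare_of_resTorsion_eq (w.1.adicCompletion K) hθE cS aK ha' P hP'
  -- images in `K_w` of `a·z = t²`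
  have hAZ : ∀ w : v.Extension (𝓞 K),
      algebraMap K (w.1.adicCompletion K) (aK : K) * algebraMap K (w.1.adicCompletion K) (evZ α (z₀, z₁, z₂)) =
        algebraMap K (w.1.adicCompletion K) tK * algebraMap K (w.1.adicCompletion K) tK := fun w => by
    rw [← map_mul, ← map_mul, hZ', htK]
  have hA0 : ∀ w : v.Extension (𝓞 K), algebraMap K (w.1.adicCompletion K) (aK : K) ≠ 0 := fun w => by
    rw [map_ne_zero_iff _ (algebraMap K _).injective]; exact aK.ne_zero
  have hZ0 : ∀ w : v.Extension (𝓞 K), algebraMap K (w.1.adicCompletion K) (evZ α (z₀, z₁, z₂)) ≠ 0 := fun w => by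
    rw [map_ne_zero_iff _ (algebraMap K _).injective, hZ']; exact hZ
  rcases P with _ | ⟨x, y, hxy⟩
  · -- locally trivial class: `z` is a square at every `w ∣ p`, the point of the covering at `n = 0`
    have hw : ∀ w : v.Extension (𝓞 K), ∃ ρw : w.1.adicCompletion K,
        algebraMap K (w.1.adicCompletion K) (evZ α (z₀, z₁, z₂)) * ρw ^ 2 = 1 := by
      intro w
      obtain ⟨s, hs⟩ := (key w).1 rfl
      exact exists_mul_sq_eq_of_sq (hA0 w) (hZ0 w) (hAZ w) (by rw [mul_one]; exact hs)
    obtain ⟨u, hprim, h1, h2⟩ := exists_primitive_killQ_dvd_of_forall_extension_one hirr hα h3 (z₀, z₁, z₂) t₁ t₂ hw N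
    exact hN u hprim h1 h2
  · -- affine point `(x, y) ∈ E(ℚ_p)`: `z·ρ_w² = x − θ` at every `w ∣ p`
    have hw : ∀ w : v.Extension (𝓞 K), ∃ ρw : w.1.adicCompletion K,
        algebraMap K (w.1.adicCompletion K) (evZ α (z₀, z₁, z₂)) * ρw ^ 2 =
          algebraMap (v.adicCompletion ℚ) (w.1.adicCompletion K) x -
            algebraMap K (w.1.adicCompletion K) (evZ α (t₀, t₁, t₂)) := by
      intro w
      obtain ⟨s, hs⟩ := (key w).2 hxy rfl
      rw [hθlin] at hs
      exact exists_mul_sq_eq_of_sq (hA0 w) (hZ0 w) (hAZ w) hs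
    obtain ⟨u, hprim, h1, h2⟩ := exists_primitive_killQ_dvd_of_forall_extension hirr hα h3 (z₀, z₁, z₂) t₀ t₁ t₂ x hw N
    exact hN u hprim h1 h2

end Summit.BirchSwinnertonDyer.BirchSwinnertonDyer.Theorems.ShaPrimaryTransferSelmerCubicKill

end
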